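import Mathlib
import Summits.ValiantsHypothesis.ValiantsHypothesis.Theorems.SymmetroidPencilBasics

/-!
# `MatrixDescartes` — negative lemma: symmetric lacunary determinants are Descartes-extremal at `(m, K) = (2, 4)`

Crux `stmt-ValiantsHypothesis-18050` (`Theses.LacunarySymmetroid.MatrixDescartes`, MDR) bets that the
number `Z` of distinct real zeros of `det (∑ₗ X^{dₗ} Sₗ)` (`Sₗ` real symmetric `m × m`, `K` terms) is
`2^{o(K log K)}` at quasi-polynomial size.  Every "law"-shaped strengthening proposed so far for the crux
(card `dimension-law`: `Z₊ ≤ K·m(m+1)/2 − m²`; its rung `QuadricRung 3`: `Z₊ ≤ 3K − 4`; the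
definite-pencil rule of Cameron–Psarrakos, doi:10.7153/oam-2019-13-48 Thm 3: `Z₊ ≤ m(K−1)`) predicts
`Z₊ ≤ 8` resp. `≤ 6` at the format `(2, 4)`, one resp. three BELOW the Descartes count
`C(m+K−1, K−1) − 1 = 9` of a generic-support `10`-nomial.

The witness (found by the line lead `prover-line-stmt-ValiantsHypothesis-18050-0`, `Lines/SketchDead.md`;
certified here in the kernel): `d = (0, 2, 6, 11)`,
`S₀ = [[5961, −24240], [−24240, 96396]]`, `S₁ = [[−15677, 32440], [32440, 27640]]`,
`S₂ = [[−1450, 95298], [95298, 15059]]`, `S₃ = [[100000, 7912], [7912, 626]]`;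
`det F` alternates in sign at `3/8 < 3/7 < 1/2 < 2/3 < 4/5 < 6/5 < 2 < 3 < 5 < 7`, so
`Z₊ ≥ 9` (`nine_le_card_posRoots_F₂₄`) — the FULL Descartes count: at `(2,4)` indefinite symmetric
pencils lose nothing to their `12`-parameter count, so no parameter-count law can be the mechanism of MDR
(`not_dimensionLaw_two_four`, `not_definiteRule_two_four`).  Harmless to MDR itself (asymptotic in `K`).

[folklore] Elementary; the sign pattern is certified by `norm_num` at rational points.
-/

-- `Summit.ValiantsHypothesis.ValiantsHypothesis.…` repeats a component by the D-0017 layout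
-- (single-conjunct summit), which the `dupNamespace` linter flags; the name is mandated.
set_option linter.dupNamespace false

namespace Summit.ValiantsHypothesis.ValiantsHypothesis.Theorems.MatrixDescartes.Negative

open Summit.ValiantsHypothesis.ValiantsHypothesis.Theorems.SymmetroidDescartes (eval_det_pencil
  le_card_posRoots_of_alternating)
open scoped BigOperators Matrix
open Polynomial

/-- The Descartes-extremal symmetric `2 × 2` four-term witness. -/
def S₂₄ : Fin 4 → Matrix (Fin 2) (Fin 2) ℝ :=
  ![!![5961, -24240; -24240, 96396], !![-15677, 32440; 32440, 27640],
    !![-1450, 95298; 95298, 15059], !![100000, 7912; 7912, 626]]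

/-- its exponents `(0, 2, 6, 11)` -/
def d₂₄ : Fin 4 → ℕ := ![0, 2, 6, 11]

/-- every coefficient of the witness is symmetric -/
theorem S₂₄_symm (l : Fin 4) : (S₂₄ l).IsSymm := by
  fin_cases l <;> (unfold Matrix.IsSymm; ext i j; fin_cases i <;> fin_cases j <;> rfl)

/-- `det F(t)` in closed form. -/
theorem eval_det_F₂₄ (t : ℝ) :
    ((∑ l, (X : ℝ[X]) ^ d₂₄ l • (S₂₄ l).map Polynomial.C).det).eval t =
      (5961 - 15677 * t ^ 2 - 1450 * t ^ 6 + 100000 * t ^ 11) *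
          (96396 + 27640 * t ^ 2 + 15059 * t ^ 6 + 626 * t ^ 11) -
        (-24240 + 32440 * t ^ 2 + 95298 * t ^ 6 + 7912 * t ^ 11) ^ 2 := by
  rw [eval_det_pencil]
  simp [Matrix.det_fin_two, Fin.sum_univ_four, S₂₄, d₂₄]
  ring

/-- ten positive test points -/
noncomputable def τ₂₄ : Fin 10 → ℝ := ![3/8, 3/7, 1/2, 2/3, 4/5, 6/5, 2, 3, 5, 7]

/-- the test points increase -/
theorem τ₂₄_strictMono : StrictMono τ₂₄ := by
  refine Fin.strictMono_iff_lt_succ.2 fun j => ?_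
  fin_cases j <;> simp [τ₂₄] <;> norm_num

/-- the test points are positive -/
theorem τ₂₄_pos (j : Fin 10) : 0 < τ₂₄ j := by
  fin_cases j <;> simp [τ₂₄]

/-- `det F` alternates in sign along the test points (`norm_num` certificate; signs
`−,+,−,+,−,+,−,+,−,+`). -/
theorem alt₂₄ (j : Fin 9) :
    ((∑ l, (X : ℝ[X]) ^ d₂₄ l • (S₂₄ l).map Polynomial.C).det).eval (τ₂₄ j.castSucc) *
      ((∑ l, (X : ℝ[X]) ^ d₂₄ l • (S₂₄ l).map Polynomial.C).det).eval (τ₂₄ j.succ) < 0 := by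
  fin_cases j <;> simp only [eval_det_F₂₄, τ₂₄] <;> simp <;> norm_num

/-- **`Z₊ ≥ 9` at `(m, K) = (2, 4)`** — the full Descartes count `C(5,3) − 1`. -/
theorem nine_le_card_posRoots_F₂₄ :
    9 ≤ ((∑ l, (X : ℝ[X]) ^ d₂₄ l • (S₂₄ l).map Polynomial.C).det.roots.toFinset.filter
      (fun t => 0 < t)).card :=
  le_card_posRoots_of_alternating _ 9 τ₂₄ τ₂₄_strictMono τ₂₄_pos alt₂₄

/-- `Z ≥ 9` for the witness (all real zeros). -/
theorem nine_le_card_roots_F₂₄ :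
    9 ≤ ((∑ l, (X : ℝ[X]) ^ d₂₄ l • (S₂₄ l).map Polynomial.C).det.roots.toFinset).card :=
  nine_le_card_posRoots_F₂₄.trans (Finset.card_filter_le _ _)

/-- A "law" at one format: every symmetric `m × m` pencil with `K` terms has at most `B` distinct
positive zeros of its determinant. -/
def PosRootLawAt (m K B : ℕ) : Prop :=
  ∀ (d : Fin K → ℕ) (S : Fin K → Matrix (Fin m) (Fin m) ℝ), (∀ l, (S l).IsSymm) →
    ((∑ l, (X : ℝ[X]) ^ d l • (S l).map Polynomial.C).det.roots.toFinset.filter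
      (fun t => 0 < t)).card ≤ B

/-- **The dimension law is false at its first non-trivial rung**: `K·m(m+1)/2 − m² = 8` at `(2,4)`,
but `Z₊ = 9` occurs (equivalently: `QuadricRung 3`, "a rank-3 quadric meets the positive moment
4-curve in at most `3K − 4 = 8` points", is false). -/
theorem not_dimensionLaw_two_four : ¬ PosRootLawAt 2 4 (4 * (2 * 3 / 2) - 2 ^ 2) := by
  intro h
  have h9 := nine_le_card_posRoots_F₂₄.trans (h d₂₄ S₂₄ S₂₄_symm)
  norm_num at h9

/-- **The definite-pencil Descartes rule does not extend to indefinite coefficients**: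
`Z₊ ≤ m(K−1) = 6` (Cameron–Psarrakos Thm 3 for definite/hyperbolic pencils) fails at `(2,4)`. -/
theorem not_definiteRule_two_four : ¬ PosRootLawAt 2 4 (2 * (4 - 1)) := by
  intro h
  have h9 := nine_le_card_posRoots_F₂₄.trans (h d₂₄ S₂₄ S₂₄_symm)
  norm_num at h9

/-- Descartes-extremality at `(2,4)`: some symmetric pencil reaches `C(m+K−1, K−1) − 1` positive zeros. -/
theorem descartes_extremal_two_four :
    ∃ (d : Fin 4 → ℕ) (S : Fin 4 → Matrix (Fin 2) (Fin 2) ℝ), (∀ l, (S l).IsSymm) ∧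
      Nat.choose (2 + 4 - 1) (4 - 1) - 1 ≤
        ((∑ l, (X : ℝ[X]) ^ d l • (S l).map Polynomial.C).det.roots.toFinset.filter
          (fun t => 0 < t)).card :=
  ⟨d₂₄, S₂₄, S₂₄_symm, by
    have h := nine_le_card_posRoots_F₂₄
    have hc : Nat.choose (2 + 4 - 1) (4 - 1) - 1 = 9 := by decide
    rw [hc]
    exact h⟩

end Summit.ValiantsHypothesis.ValiantsHypothesis.Theorems.MatrixDescartes.Negative
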